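import Literature.NumberTheory.Transcendental.TorusConeCount
import Literature.RingTheory.Nullstellensatz.PerronTheorem
import Mathlib.Algebra.MvPolynomial.Monad
import HarnessLib

/-!
# The number of points of a finite affine variety: `|Z(f_1, …, f_s)| ≤ dⁿ`

Topic `Literature/RingTheory/ZeroDimensional`. The zero-dimensional case of **Bézout's
inequality**: if finitely many (or any number of) complex polynomials of degree `≤ d` in `n`
variables have a FINITE common zero set `V ⊆ ℂⁿ`, then `|V| ≤ dⁿ` (Heintz 1983; Bürgisser–
Clausen–Shokrollahi, *Algebraic Complexity Theory*, Thm. 8.28 with (8.31) "`deg Z(f_1, …, f_r) ≤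
∏ deg f_i`"; for `n` equations the classical Bézout bound without multiplicities). This is the
hypothesis `hBez` of Bürgisser's Thm. 4.5 / Krick–Pardo shape-lemma glue
(`Literature.Computability.AlgebraicComplexity.krickPardo_shape_of_bezout_of_pointHeights`),
PROVED here (`ncard_zeroSet_le_pow_int`).

## Proof

The tree already contains the projective engine: the Philippon-type count of the relevant
top-dimensional minimal primes of a homogeneous ideal generated by forms of degree `≤ D`
(`Literature.RingTheory.MvPolynomial.card_le_pow_of_relevant_minimalPrimes`, Nesterenko–Philippon
LNM 1752, Ch. 11, Prop. 2.2, via Hilbert polynomials) and its consequence for the torus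
`(ℂˣ)ⁿ`: a finite union of cosets of a subtorus `H_A` cut out in the torus by polynomials of degree
`≤ D` meets at most `D^{rank A}` cosets
(`Literature.NumberTheory.Transcendental.ncard_image_mk_le_pow`, `TorusConeCount.lean`). Taking
`A = ℤⁿ` (`H_A = {1}`, `subtorus_top`) bounds the number of torus points of a finite torus zero
set by `Dⁿ` (`ncard_le_pow_of_forall_ne_zero`); a translation `x ↦ x + t` avoiding the finitely
many coordinates of the points moves any finite zero set into the torus without changing degrees
(`ncard_le_pow_of_finite`); constants (`D = 0`) and integer coefficients are bookkeeping
(`ncard_zeroSet_le_pow`, `ncard_zeroSet_le_pow_int`).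

## References

* J. Heintz, *Definability and fast quantifier elimination in algebraically closed fields*,
  Theoret. Comput. Sci. 24 (1983) 239–277, Thm. 2, Cor. 1 (Bézout inequality).
* P. Bürgisser, M. Clausen, M. A. Shokrollahi, *Algebraic Complexity Theory*, Grundlehren 315
  (1997), Thm. 8.28, (8.31). [BurgisserClausenShokrollahi1997]
* Yu. V. Nesterenko, P. Philippon (eds.), *Introduction to Algebraic Independence Theory*,
  LNM 1752 (2001), Ch. 11, Prop. 2.2. [NesterenkoPhilippon2001]
-/

noncomputable section

open MvPolynomial Literature.NumberTheory.Transcendental Literature.NumberTheory.Transcendental.Torus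

namespace Literature.RingTheory.ZeroDimensional

/-! ### Step 1: points of the torus -/

/-- The algebraic subgroup attached to all characters is trivial: `H_{ℤⁿ} = {1}`. [folklore] -/
theorem subtorus_top (n : ℕ) : subtorus (⊤ : AddSubgroup (Fin n → ℤ)) = ⊥ := by
  ext z
  simp only [mem_subtorus, AddSubgroup.mem_top, forall_const, Subgroup.mem_bot]
  constructor
  · intro h
    funext i
    have := h (Pi.single i 1)
    rw [char_apply, Finset.prod_eq_single i (fun j _ hj => by rw [Pi.single_eq_of_ne hj, zpow_zero])
      (fun hi => (hi (Finset.mem_univ i)).elim), Pi.single_eq_same, zpow_one] at this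
    rw [this]; rfl
  · rintro rfl a; exact map_one _

/-- **Finitely many torus points cut out by polynomials of degree `≤ D` number at most `Dⁿ`**
(the case `A = ℤⁿ`, `H_A = {1}` of the tree's
`Literature.NumberTheory.Transcendental.ncard_image_mk_le_pow`, Nesterenko–Philippon LNM 1752,
Ch. 11, Prop. 2.2 for `G = 𝔾ₘⁿ`). [cite: NesterenkoPhilippon2001, Ch. 11 Prop 2.2] -/
theorem ncard_le_pow_of_forall_ne_zero {n D : ℕ} (hD : 1 ≤ D) (𝓕 : Set (MvPolynomial (Fin n) ℂ))
    (hdeg : ∀ q ∈ 𝓕, q.totalDegree ≤ D) {V : Set (Fin n → ℂ)}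
    (hV : ∀ z, z ∈ V ↔ ∀ q ∈ 𝓕, eval z q = 0) (hfin : V.Finite) (hne : ∀ z ∈ V, ∀ i, z i ≠ 0) :
    V.ncard ≤ D ^ n := by
  classical
  set coords : Torus n → (Fin n → ℂ) := fun g i => ((g i : ℂˣ) : ℂ) with hcoords
  have hinj : Function.Injective coords := by
    intro g g' h
    funext i
    exact Units.ext (congr_fun h i)
  set E : Set (Torus n) := coords ⁻¹' V with hE
  have hEmem : ∀ g : Torus n, g ∈ E ↔ ∀ q ∈ 𝓕, aevalAt q g = 0 := fun g => by
    rw [hE, Set.mem_preimage, hV]; rfl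
  have hVE : V = coords '' E := by
    ext z
    constructor
    · intro hz
      have hcz : coords (fun i => Units.mk0 (z i) (hne z hz i)) = z := funext fun i => rfl
      exact ⟨fun i => Units.mk0 (z i) (hne z hz i), by rw [hE, Set.mem_preimage, hcz]; exact hz, hcz⟩
    · rintro ⟨g, hg, rfl⟩; exact hg
  have hEfin : E.Finite := hfin.preimage hinj.injOn
  set π : Torus n → Torus n ⧸ subtorus (⊤ : AddSubgroup (Fin n → ℤ)) := QuotientGroup.mk with hπ
  have hπinj : Function.Injective π := by
    intro a b h
    have := QuotientGroup.eq.1 h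
    rw [subtorus_top, Subgroup.mem_bot, inv_mul_eq_one] at this
    exact this
  have hcount := ncard_image_mk_le_pow (A := (⊤ : AddSubgroup (Fin n → ℤ))) (E := E) hD hdeg hEmem
    (fun g hg h hh => by
      rw [subtorus_top, Subgroup.mem_bot] at hh
      rwa [hh, mul_one])
    (hEfin.image _)
  rw [Set.ncard_image_of_injective _ hπinj, map_top, finrank_top, Module.finrank_fin_fun] at hcount
  rwa [hVE, Set.ncard_image_of_injective _ hinj]

/-! ### Step 2: translation into the torus -/

/-- `deg p(X - t) ≤ deg p`. [folklore] -/
theorem totalDegree_aeval_X_sub_C_le {n : ℕ} (t : Fin n → ℂ) (p : MvPolynomial (Fin n) ℂ) :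
    (aeval (fun j => X j - C (t j)) p).totalDegree ≤ p.totalDegree := by
  have h := Literature.RingTheory.Nullstellensatz.totalDegree_aeval_le
    (fun j => (X j - C (t j) : MvPolynomial (Fin n) ℂ)) (δ := 1)
    (fun j => (totalDegree_sub_C_le _ _).trans (by rw [totalDegree_X])) p
  simpa using h

/-- `p(X - t)` at `w` is `p` at `w - t`. [folklore] -/
theorem eval_aeval_X_sub_C {n : ℕ} (t w : Fin n → ℂ) (p : MvPolynomial (Fin n) ℂ) :
    eval w (aeval (fun j => X j - C (t j)) p) = eval (w - t) p := by
  rw [aeval_eq_bind₁]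
  change eval₂Hom (RingHom.id ℂ) w (bind₁ _ p) = eval₂Hom (RingHom.id ℂ) (w - t) p
  rw [eval₂Hom_bind₁]
  congr 2
  funext i
  simp

/-- **The number of points of a finite set cut out by complex polynomials of degree `≤ D`
(`D ≥ 1`) in `ℂⁿ` is at most `Dⁿ`** — the zero-dimensional case of Bézout's inequality (Heintz
1983; Bürgisser–Clausen–Shokrollahi, Thm. 8.28; for `n` equations the classical Bézout bound): a
translation `x ↦ x + t` moves the finitely many points into the torus `(ℂˣ)ⁿ`, where the tree's
Philippon-type count applies (`ncard_le_pow_of_forall_ne_zero`).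
[cite: NesterenkoPhilippon2001, Ch. 11 Prop 2.2] -/
theorem ncard_le_pow_of_finite {n D : ℕ} (hD : 1 ≤ D) (𝓕 : Set (MvPolynomial (Fin n) ℂ))
    (hdeg : ∀ q ∈ 𝓕, q.totalDegree ≤ D) {V : Set (Fin n → ℂ)}
    (hV : ∀ z, z ∈ V ↔ ∀ q ∈ 𝓕, eval z q = 0) (hfin : V.Finite) : V.ncard ≤ D ^ n := by
  classical
  -- a translation vector avoiding the coordinates of the points
  have ht : ∀ i : Fin n, ∃ c : ℂ, ∀ z ∈ V, z i + c ≠ 0 := by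
    intro i
    obtain ⟨c, hc⟩ := (hfin.image fun z : Fin n → ℂ => -z i).infinite_compl.nonempty
    refine ⟨c, fun z hz h => hc ⟨z, hz, ?_⟩⟩
    linear_combination -h
  choose t ht using ht
  -- the translated family and zero set
  set 𝓕' : Set (MvPolynomial (Fin n) ℂ) := (fun q => aeval (fun j => X j - C (t j)) q) '' 𝓕 with h𝓕'
  set V' : Set (Fin n → ℂ) := (fun z => z + t) '' V with hV'
  have hV'mem : ∀ w, w ∈ V' ↔ ∀ q ∈ 𝓕', eval w q = 0 := by
    intro w
    rw [h𝓕', Set.forall_mem_image]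
    simp only [eval_aeval_X_sub_C]
    rw [← hV (w - t), hV']
    constructor
    · rintro ⟨z, hz, rfl⟩; simpa using hz
    · intro h; exact ⟨w - t, h, by simp⟩
  have hdeg' : ∀ q ∈ 𝓕', q.totalDegree ≤ D := by
    rintro _ ⟨q, hq, rfl⟩
    exact (totalDegree_aeval_X_sub_C_le t q).trans (hdeg q hq)
  have hne' : ∀ w ∈ V', ∀ i, w i ≠ 0 := by
    rintro _ ⟨z, hz, rfl⟩ i
    exact ht i z hz
  have hinj : Function.Injective fun z : Fin n → ℂ => z + t := fun a b h => add_right_cancel h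
  have h := ncard_le_pow_of_forall_ne_zero hD 𝓕' hdeg' hV'mem (hfin.image _) hne'
  rwa [hV', Set.ncard_image_of_injective _ hinj] at h

/-! ### Step 3: all degrees, and integer coefficients -/

/-- **Zero-dimensional Bézout inequality** (Heintz 1983, Thm. 2 and Cor. 1; Bürgisser–Clausen–
Shokrollahi, *Algebraic Complexity Theory*, Thm. 8.28 and (8.31)): a FINITE subset of `ℂⁿ` which is
the common zero set of complex polynomials of degree `≤ D` has at most `Dⁿ` points. (For `D = 0`
the polynomials are constants and the finite zero set is empty unless `n = 0`.)
[cite: NesterenkoPhilippon2001, Ch. 11 Prop 2.2] -/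
theorem ncard_zeroSet_le_pow {n D : ℕ} (𝓕 : Set (MvPolynomial (Fin n) ℂ))
    (hdeg : ∀ q ∈ 𝓕, q.totalDegree ≤ D) {V : Set (Fin n → ℂ)}
    (hV : ∀ z, z ∈ V ↔ ∀ q ∈ 𝓕, eval z q = 0) (hfin : V.Finite) : V.ncard ≤ D ^ n := by
  classical
  rcases Nat.eq_zero_or_pos D with rfl | hD
  swap
  · exact ncard_le_pow_of_finite hD 𝓕 hdeg hV hfin
  rcases Nat.eq_zero_or_pos n with rfl | hn
  · rw [pow_zero]
    calc V.ncard ≤ (Set.univ : Set (Fin 0 → ℂ)).ncard := Set.ncard_le_ncard (Set.subset_univ V)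
      _ = 1 := by rw [Set.ncard_univ, Nat.card_unique]
  -- `n ≥ 1`, all polynomials constant: the zero set is empty or everything
  rw [zero_pow hn.ne']
  by_cases hc : ∃ q ∈ 𝓕, coeff 0 q ≠ 0
  · obtain ⟨q, hq, hq0⟩ := hc
    have hVe : V = ∅ := by
      ext z
      simp only [Set.mem_empty_iff_false, iff_false]
      intro hz
      have h1 := (hV z).1 hz q hq
      rw [(totalDegree_eq_zero_iff_eq_C).1 (Nat.le_zero.1 (hdeg q hq)), eval_C] at h1
      exact hq0 h1
    rw [hVe, Set.ncard_empty]
  · push Not at hc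
    have hVu : V = Set.univ := by
      ext z
      simp only [Set.mem_univ, iff_true]
      rw [hV]
      intro q hq
      rw [(totalDegree_eq_zero_iff_eq_C).1 (Nat.le_zero.1 (hdeg q hq)), eval_C, hc q hq]
    exfalso
    haveI : Nonempty (Fin n) := ⟨⟨0, hn⟩⟩
    have hinf : (Set.univ : Set (Fin n → ℂ)).Infinite := by
      have : Infinite (Fin n → ℂ) :=
        Infinite.of_injective (fun c : ℂ => fun _ : Fin n => c)
          (fun a b h => congr_fun h (Classical.arbitrary (Fin n)))
      exact Set.infinite_univ
    exact hinf (hVu ▸ hfin)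

/-- `deg (map f p) ≤ deg p`. [folklore] -/
theorem totalDegree_map_le' {R S σ : Type*} [CommSemiring R] [CommSemiring S] (f : R →+* S)
    (p : MvPolynomial σ R) : (map f p).totalDegree ≤ p.totalDegree :=
  Finset.sup_mono (support_map_subset f p)

/-- **Zero-dimensional Bézout for integer systems** (the hypothesis `hBez` of
`Literature.Computability.AlgebraicComplexity.krickPardo_shape_of_bezout_of_pointHeights`, in the
form consumed there): for `F_1, …, F_n ∈ ℤ[X_1, …, X_n]` of degree `≤ d` with finite complex zero
set `V`, `|V| ≤ dⁿ`. [cite: NesterenkoPhilippon2001, Ch. 11 Prop 2.2] -/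
theorem ncard_zeroSet_le_pow_int (n d : ℕ) (F : Fin n → MvPolynomial (Fin n) ℤ)
    (hdeg : ∀ i, (F i).totalDegree ≤ d)
    (hfin : {z : Fin n → ℂ | ∀ i, aeval z (F i) = 0}.Finite) :
    {z : Fin n → ℂ | ∀ i, aeval z (F i) = 0}.ncard ≤ d ^ n := by
  refine ncard_zeroSet_le_pow (Set.range fun i => map (Int.castRingHom ℂ) (F i)) ?_ ?_ hfin
  · rintro _ ⟨i, rfl⟩
    exact (totalDegree_map_le' _ _).trans (hdeg i)
  · intro z
    simp only [Set.mem_setOf_eq, Set.forall_mem_range, eval_map, ← algebraMap_int_eq]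
    rfl

end Literature.RingTheory.ZeroDimensional

end
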